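import Literature.MathematicalPhysics.QuantumFieldTheory.Balaban1983to89.B9Eq388KhCommutatorLattice

/-!
# `Balaban1983to89.B9Eq388KhCommutatorWeighted` — T. Bałaban, *Propagators for lattice gauge theories in a background field*, Commun. Math. Phys.
# **99** (1985) 389–434 [Balaban1985BackgroundPropagators] (3.88)–(3.89) p. 409 with (3.100) p. 413, (3.102) p. 414, (3.49) p. 399: **PRINT's COMMUTATOR
# `K(h)` AGAINST THE WEIGHTS — THE LETTERS `τ`, `a₁`, `a₀`, `b₀` OF THE WEIGHTED FORM OF S-P6′(β)**: for a cutoff `σ` whose first ∕ second differences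
# are dominated POINTWISE by non-negative weights (`|σ(b₋) − σ(b₊)| ≤ θ₁w_E(b)`, `|Δ²_μσ(y)| ≤ θ₂w(y)`, `|σ(x) − 1| ≤ τw(x)`) and maps `W`, `W_E` acting as
# multiplication by `w`, `w_E`: `‖Θf − f‖ ≤ τ‖Wf‖`, `‖D*(D(Θf)) − Θ(D*(Df))‖ ≤ √d‖c′‖θ₁(M_T + 1)·‖W_E(Df)‖ + d‖c′‖‖c‖θ₂·‖Wf‖`, and for the scalar
# averaging `‖T(χ_Sλ) − χ_G(Tλ)‖ ≤ M_Aϑ·‖Wλ‖` (`|χ′(y) − χ(x)| ≤ ϑw(x)` on blocks) — the DISPLAYED hypotheses `hτ`, `ha`, `hb` of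
# `B9Eq387CubeLocalisedProjection.norm_sub_projR_cube_le_weighted` («letters in, `ε_M` out») INHABITED at the lattice; the smallness `e^{−κr}` is read off
# a cutoff FLAT WHERE THE WEIGHT IS SMALL (§6)

statement-level skeleton of published theorems with citation tags; proofs where landed; nothing here is a claim about the Yang–Mills mass gap

CITATION HEADER (lean-in-tree rule).  Audit cell `pub-balaban`, sub-cell `t4`, BINDER row NE9; filed by NE9 formalisation-swarm leaf prover 05
(`b2b-balaban-t4-ne9-formalise-leaf-05`, gen 75) — the WEIGHTED twin of this lineage's `B9Eq388KhCommutatorLattice` (gen 74), which inhabited the NEAR-FIELD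
letters of `norm_sub_projR_cube_le_nearfield`.  CONSUMER BY SHAPE: ne9-leaf-06's `B9Eq387CubeLocalisedProjection.norm_sub_projR_cube_le_weighted` (§3 (β))
takes `hτ : ∀ u, ‖θ u − u‖ ≤ τ‖W u‖`, `ha : ∀ u, ‖Δs (θ u) − θ (Δs u)‖ ≤ a₁‖W_E (D u)‖ + a₀‖W u‖` (`Δs = D†D`), `hb : ∀ u, ‖Q′(θ u) − θ_F(Q′ u)‖ ≤ b₀‖W u‖`
for weight maps `W`, `W_E` (route R2′ STEP B8′ S-P6′(β), `t4/ROUTES-NE9.md` v13.34 ADDENDUM (iv)(b): «a prover who wants the true rate uses the weighted form …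
letters against `e^{κχ}`»).  This file supplies `τ`, `a₁`, `a₀`, `b₀` for REAL non-negative weights acting pointwise (`w := e^{κχ}` through ne9-leaf-01's
`B9Eq3101ExpPointwiseMultiplier.equiv_exp_smul_apply_real` is the junction-writer's line); `C_R`, `C_G`, `C_{DG}` (conjugated projection ∕ Green's function —
`B9Eq349ConjugatedProjection`, `B9Eq349ConjugatedGreenLetters`), `C_Ψ` (`B9Eq319BumpSectionTorus` + ne9-leaf-06's plug) are NOT here.  TOOLS BY NAME:
ne9-leaf-04's `B9Eq3100LeibnizCommutatorDiv` (`comm_covDiv_apply`, `norm_site_le_of_instar_bound`), `B9Eq373DerivativeRemainderL2.norm_le_of_sum_sq_le`, this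
lineage's `B9Eq388KhCommutatorLattice` (`covDiv_comm_covDeriv_apply`, `norm_site_le_of_outstar_bound`), `B9Eq3102QprimeCommutatorLetters.norm_comm_QprimeLin_apply_le`,
`B9Eq319QprimeLipschitz` (`blockMean_norm_sq_le`, `sum_blockOf_sum`).  Source READ in the held text (`paper:balaban1985-cmp99-background-propagators`, journal
page = PDF page + 388): p. 409 (3.88) *«(Δ′_a h_□λ)(x) = h(x)(Δ′_aλ)(x) − (K(h)λ)(x)»*, (3.89) *«|(K(h_□)G′_□h_□λ)(x)| ≤ O(M⁻¹)e^{−δ₀…}|λ|»*; p. 413 (3.100)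
*«… the commutators [D*D, h] and [DD*, h] are first order differential operators with coefficients determined by derivatives of the function h»*; p. 414
(3.102) *«(Q_j hA)(c) = h(c₋)(Q_jA)(c) + (S_j(∂h)A)(c)»*; p. 399 (3.49) (exponential decay of the kernels — the weights `e^{−δ|x−y|}`).
WHY.  In the weighted form of (β) the smallness `ε_M` is NOT `O(M⁻¹)`: it is carried by the weight — the cutoff's increments live on a collar where
`w = e^{κχ}` is large, so every commutator coefficient is `≤ (size)·e^{−κr}·w` POINTWISE; the `L²` letters then come out against `‖Wu‖`, `‖W_E(Du)‖` by the
same Leibniz algebra and Cauchy–Schwarz as the near-field file, with the weight riding inside the pointwise bounds.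
WHAT IS PROVED (sorry-free; proof lane — no `def`; [folklore] Leibniz algebra + Cauchy–Schwarz + order facts; nothing of [B9] asserted):
§1 `norm_real_smul`, **`norm_le_of_pointwise_le`**; §2 **`norm_comm_covDivL2K_le_weighted`**; §3 **`norm_lap_comm_le_weighted`** (`a₁ = √d‖c′‖θ₁(M_T + 1)`,
`a₀ = d‖c′‖‖c‖θ₂` against `‖W_E(Df)‖`, `‖Wf‖`); §4 **`norm_mul_sub_self_le_weighted`** (`τ`); §5 `norm_comm_QprimeLin_apply_le_weighted`,
`sum_norm_sq_comm_QprimeLin_le_weighted`, **`norm_comm_T_le_weighted`**, **`norm_comm_T_le_weighted_diagonal`** (`b₀ = M_Aϑ`); §6 **`abs_le_div_mul_of_support`**,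
**`abs_le_mul_exp_of_support`** (the extraction `θ ↦ θe^{−κr}`), `exp_weight_step_le` (one lattice step costs `e^{κℓ}`); §7 non-vacuity (`w ≡ 1`: the near-field letters).
HONEST SCOPE.  Letters of THREE displayed hypotheses of ONE sub-step (S-P6′(β), weighted form) for ANY cutoff ∕ weight pair with the stated pointwise
dominations; the choice `(θ, χ, κ)` at the chain, `Δs = D†D` (`B11Eq103H1Complex.adjoint_covDerivL2K` under `hRS`) and the `∃ ε_M` line are the consumer's;
`C_R`, `C_G`, `C_{DG}`, `C_Ψ` NOT here; no decay of [B9] (3.49)∕(3.89) asserted; NOT NE9 (cell pub-balaban: NE9 NOT PRINTED ∕ NOT PROVED; «NE9 ⇐ the named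
binders»; spine PROVED 0∕9; rung (B)+1 on a finite T⁴ — NOT infinite volume, NOT mass gap, NOT Clay; HONEST DEPENDENCY: continuum YM on T⁴ ⇐ BetaPertH ∧
nine spine estimates (0/9 proved); BetaPertH ⇐ (D1) ∧ (D4) ∧ CAP+tail; G-an2-4 gates asym, D1 and NE2/3/4).  NEW file; nothing modified.  Net new unproved facts: 0.
-/

noncomputable section

namespace Literature.MathematicalPhysics.QuantumFieldTheory.Balaban1983to89.B9Eq388KhCommutatorWeighted

open B4Sect5Torus (TSite)
open B9SectCLatticeCarrier (Bond bpos btgt shift unshift shift_unshift)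
open B9Eq33CovDerivVector (covDeriv covDeriv_apply covDiv covDiv_apply)
open B9Eq311L2Pairing (WL2)
open B11Eq103H1Complex (SiteL2K BondL2K covDerivL2K covDivL2K equiv_covDerivL2K equiv_covDivL2K)
open B9Eq373DerivativeRemainderL2 (norm_le_of_sum_sq_le)
open B9Eq3100LeibnizCommutatorDiv (comm_covDiv_apply norm_site_le_of_instar_bound)
open B9Eq388KhCommutatorLattice (comm_covDeriv_apply covDiv_comm_covDeriv_apply norm_site_le_of_outstar_bound norm_lap_comm_le)
open B9Eq323Ker (pathTr)
open B9Eq319QprimeTorus (fineP centre contour stepTransport QprimeLin)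
open B9Eq319QprimeLipschitz (blockMean_norm_sq_le sum_blockOf_sum)
open B9Eq3102QprimeCommutatorLetters (norm_comm_QprimeLin_apply_le)

/-! ## §1 Tools: real non-negative multipliers; pointwise domination on a common index set gives `L²` domination -/
section Tool
variable {𝕜 : Type*} [RCLike 𝕜] {X V V' : Type*} [Fintype X] [NormedAddCommGroup V] [InnerProductSpace 𝕜 V]
  [NormedAddCommGroup V'] [InnerProductSpace 𝕜 V'] {w : X → ℝ} [Fact (∀ x, 0 < w x)]

omit [InnerProductSpace 𝕜 V] in
/-- a real non-negative scalar acts on norms by multiplication: `‖(r : 𝕜)•v‖ = r‖v‖`. [folklore] [cite: Balaban1985BackgroundPropagators, (3.11) p.392] -/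
theorem norm_real_smul [NormedSpace 𝕜 V] {r : ℝ} (hr : 0 ≤ r) (v : V) : ‖(r : 𝕜) • v‖ = r * ‖v‖ := by
  rw [norm_smul, RCLike.norm_ofReal, abs_of_nonneg hr]

/-- **POINTWISE DOMINATION ⇒ `L²` DOMINATION** on weighted carriers over the SAME index set and weight: `‖G(x)‖ ≤ K‖H(x)‖` at every `x` (`0 ≤ K`) gives
`‖G‖ ≤ K‖H‖`. [folklore] [cite: Balaban1985BackgroundPropagators, (3.11) p.392] -/
theorem norm_le_of_pointwise_le (G : WL2 𝕜 w V) (H : WL2 𝕜 w V') {K : ℝ} (hK : 0 ≤ K)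
    (h : ∀ x, ‖WL2.equiv 𝕜 w V G x‖ ≤ K * ‖WL2.equiv 𝕜 w V' H x‖) : ‖G‖ ≤ K * ‖H‖ := by
  have hw : ∀ x, 0 < w x := Fact.out
  refine norm_le_of_sum_sq_le H G hK ?_
  rw [Finset.mul_sum]
  refine Finset.sum_le_sum fun x _ => ?_
  have h1 : ‖WL2.equiv 𝕜 w V G x‖ ^ 2 ≤ (K * ‖WL2.equiv 𝕜 w V' H x‖) ^ 2 := pow_le_pow_left₀ (norm_nonneg _) (h x) 2
  calc w x * ‖WL2.equiv 𝕜 w V G x‖ ^ 2 ≤ w x * (K * ‖WL2.equiv 𝕜 w V' H x‖) ^ 2 := mul_le_mul_of_nonneg_left h1 (hw x).le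
    _ = K ^ 2 * (w x * ‖WL2.equiv 𝕜 w V' H x‖ ^ 2) := by ring

end Tool

/-! ## §2 The divergence commutator against a bond weight -/
section Div
variable {𝕜 : Type*} [RCLike 𝕜] {d : ℕ} {Pd : Fin d → ℕ} {W : Type*} [NormedAddCommGroup W] [InnerProductSpace 𝕜 W]
  {c₀ : ℝ} [Fact (0 < c₀)] {S : Bond d Pd → W →ₗ[𝕜] W} {MT : ℝ}
  (χS : BondL2K 𝕜 d Pd c₀ W → BondL2K 𝕜 d Pd c₀ W) (χ0 : SiteL2K 𝕜 d Pd c₀ W → SiteL2K 𝕜 d Pd c₀ W) {χ : TSite d Pd → ℝ}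
  (WEm : BondL2K 𝕜 d Pd c₀ W → BondL2K 𝕜 d Pd c₀ W) {wE : Bond d Pd → ℝ}

/-- **THE SINGLE DIVERGENCE COMMUTATOR AGAINST A BOND WEIGHT**: maps `χ_S` (bonds, `χ(b₋)`), `χ_0` (sites, `χ(y)`), `W_E` (bonds, a real weight
`w_E ≥ 0`) acting as the multiplications, increments dominated by the weight `|χ(b₋) − χ(b₊)| ≤ θ·w_E(b)` (`0 ≤ θ`), transporters `‖S(b)v‖ ≤ M_T‖v‖`:
`‖χ_0(D*A) − D*(χ_S A)‖ ≤ √d·‖c‖θM_T·‖W_E A‖` — ne9-leaf-04's `norm_comm_covDivL2K_le` with the weight riding inside the in-star bound. [folklore]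
[cite: Balaban1985BackgroundPropagators, (3.100) p.413, (3.89) p.409, (3.8) p.392] -/
theorem norm_comm_covDivL2K_le_weighted (hMT : 0 ≤ MT) (hR : ∀ b v, ‖S b v‖ ≤ MT * ‖v‖) {θ : ℝ} (hθ : 0 ≤ θ) (hwE : ∀ b, 0 ≤ wE b)
    (hχ : ∀ b : Bond d Pd, |χ (bpos b) - χ (btgt b)| ≤ θ * wE b)
    (hS : ∀ (A : BondL2K 𝕜 d Pd c₀ W) (b : Bond d Pd), WL2.equiv 𝕜 _ W (χS A) b = (χ (bpos b) : 𝕜) • WL2.equiv 𝕜 _ W A b)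
    (h0 : ∀ (f : SiteL2K 𝕜 d Pd c₀ W) (y : TSite d Pd), WL2.equiv 𝕜 _ W (χ0 f) y = (χ y : 𝕜) • WL2.equiv 𝕜 _ W f y)
    (hWE : ∀ (A : BondL2K 𝕜 d Pd c₀ W) (b : Bond d Pd), WL2.equiv 𝕜 _ W (WEm A) b = (wE b : 𝕜) • WL2.equiv 𝕜 _ W A b)
    (c : 𝕜) (A : BondL2K 𝕜 d Pd c₀ W) :
    ‖χ0 (covDivL2K 𝕜 c₀ c S A) - covDivL2K 𝕜 c₀ c S (χS A)‖ ≤ Real.sqrt d * (‖c‖ * θ * MT) * ‖WEm A‖ := by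
  refine norm_site_le_of_instar_bound (WEm A) _ (by positivity) fun y => ?_
  set a : Bond d Pd → W := WL2.equiv 𝕜 _ W A with ha
  have hSA : WL2.equiv 𝕜 _ W (χS A) = fun b => (χ (bpos b) : 𝕜) • a b := funext (hS A)
  rw [WL2.equiv_sub, Pi.sub_apply, h0, equiv_covDivL2K, equiv_covDivL2K, hSA, comm_covDiv_apply (fun x => (χ x : 𝕜)) c S _ y, norm_smul]
  simp only [← RCLike.ofReal_sub]
  have hterm : ∀ μ : Fin d, ‖((χ y - χ (unshift μ y) : ℝ) : 𝕜) • S (unshift μ y, μ) (a (unshift μ y, μ))‖ ≤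
      θ * MT * ‖WL2.equiv 𝕜 _ W (WEm A) (unshift μ y, μ)‖ := fun μ => by
    have h := hχ (unshift μ y, μ)
    simp only [bpos, btgt, shift_unshift] at h
    rw [abs_sub_comm] at h
    rw [norm_smul, RCLike.norm_ofReal, hWE, norm_real_smul (hwE _)]
    calc |χ y - χ (unshift μ y)| * ‖S (unshift μ y, μ) (a (unshift μ y, μ))‖
        ≤ (θ * wE (unshift μ y, μ)) * (MT * ‖a (unshift μ y, μ)‖) := mul_le_mul h (hR _ _) (norm_nonneg _) (mul_nonneg hθ (hwE _))
      _ = θ * MT * (wE (unshift μ y, μ) * ‖a (unshift μ y, μ)‖) := by ring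
  calc ‖c‖ * ‖∑ μ, ((χ y - χ (unshift μ y) : ℝ) : 𝕜) • S (unshift μ y, μ) (a (unshift μ y, μ))‖
      ≤ ‖c‖ * ∑ μ, θ * MT * ‖WL2.equiv 𝕜 _ W (WEm A) (unshift μ y, μ)‖ :=
        mul_le_mul_of_nonneg_left ((norm_sum_le _ _).trans (Finset.sum_le_sum fun μ _ => hterm μ)) (norm_nonneg c)
    _ = ‖c‖ * θ * MT * ∑ μ, ‖WL2.equiv 𝕜 _ W (WEm A) (unshift μ y, μ)‖ := by rw [← Finset.mul_sum]; ring

end Div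

/-! ## §3 Print's `K(h)` for the site Laplacian `D*D` against the weights: the `ha` letter of the weighted (β) -/
section Lap
variable {𝕜 : Type*} [RCLike 𝕜] {d : ℕ} {Pd : Fin d → ℕ} {W : Type*} [NormedAddCommGroup W] [InnerProductSpace 𝕜 W]
  {c₀ : ℝ} [Fact (0 < c₀)] {R S : Bond d Pd → W →ₗ[𝕜] W} {MT : ℝ}

/-- **PRINT's `K(h)` FOR `D*D` AGAINST THE WEIGHTS** — maps `Θ` (sites, `σ`), `Θ_B` (bonds, `σ(b₋)`), `W` (sites, real `w ≥ 0`), `W_E` (bonds, real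
`w_E ≥ 0`) acting as the multiplications; first differences dominated by the bond weight `|σ(b₋) − σ(b₊)| ≤ θ₁·w_E(b)`, second differences by the site weight
`|(σ(y) − σ(y−e_μ)) − (σ(y+e_μ) − σ(y))| ≤ θ₂·w(y)`; transporters `‖S_bv‖ ≤ M_T‖v‖` with `S_b∘R_b = 1`:
`‖D*(D(Θf)) − Θ(D*(Df))‖ ≤ √d‖c′‖θ₁(M_T + 1)·‖W_E(Df)‖ + d‖c′‖‖c‖θ₂·‖Wf‖` — the `ha` shape of `B9Eq387CubeLocalisedProjection.norm_sub_projR_cube_le_weighted`,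
`a₁ = √d‖c′‖θ₁(M_T + 1)`, `a₀ = d‖c′‖‖c‖θ₂`. [folklore] [cite: Balaban1985BackgroundPropagators, (3.88)–(3.89) p.409, (3.100) p.413] -/
theorem norm_lap_comm_le_weighted (hMT : 0 ≤ MT) (hS : ∀ b v, ‖S b v‖ ≤ MT * ‖v‖) (hSR : ∀ b v, S b (R b v) = v)
    {σ w : TSite d Pd → ℝ} {wE : Bond d Pd → ℝ} {θ₁ θ₂ : ℝ} (hθ₁ : 0 ≤ θ₁) (hθ₂ : 0 ≤ θ₂) (hw : ∀ x, 0 ≤ w x) (hwE : ∀ b, 0 ≤ wE b)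
    (h1 : ∀ b : Bond d Pd, |σ (bpos b) - σ (btgt b)| ≤ θ₁ * wE b)
    (h2 : ∀ (y : TSite d Pd) (μ : Fin d), |(σ y - σ (unshift μ y)) - (σ (shift μ y) - σ y)| ≤ θ₂ * w y)
    (Θ Wm : SiteL2K 𝕜 d Pd c₀ W → SiteL2K 𝕜 d Pd c₀ W) (ΘB WEm : BondL2K 𝕜 d Pd c₀ W → BondL2K 𝕜 d Pd c₀ W)
    (hΘ : ∀ (f : SiteL2K 𝕜 d Pd c₀ W) (x : TSite d Pd), WL2.equiv 𝕜 _ W (Θ f) x = (σ x : 𝕜) • WL2.equiv 𝕜 _ W f x)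
    (hΘB : ∀ (A : BondL2K 𝕜 d Pd c₀ W) (b : Bond d Pd), WL2.equiv 𝕜 _ W (ΘB A) b = (σ (bpos b) : 𝕜) • WL2.equiv 𝕜 _ W A b)
    (hWm : ∀ (f : SiteL2K 𝕜 d Pd c₀ W) (x : TSite d Pd), WL2.equiv 𝕜 _ W (Wm f) x = (w x : 𝕜) • WL2.equiv 𝕜 _ W f x)
    (hWEm : ∀ (A : BondL2K 𝕜 d Pd c₀ W) (b : Bond d Pd), WL2.equiv 𝕜 _ W (WEm A) b = (wE b : 𝕜) • WL2.equiv 𝕜 _ W A b)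
    (c c' : 𝕜) (f : SiteL2K 𝕜 d Pd c₀ W) :
    ‖covDivL2K 𝕜 c₀ c' S (covDerivL2K 𝕜 c₀ c R (Θ f)) - Θ (covDivL2K 𝕜 c₀ c' S (covDerivL2K 𝕜 c₀ c R f))‖ ≤
      Real.sqrt d * ‖c'‖ * θ₁ * (MT + 1) * ‖WEm (covDerivL2K 𝕜 c₀ c R f)‖ + d * ‖c'‖ * ‖c‖ * θ₂ * ‖Wm f‖ := by
  set l : TSite d Pd → W := WL2.equiv 𝕜 _ W f with hl
  set Df := covDerivL2K 𝕜 c₀ c R f with hDf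
  -- the bond field `ad f := D(Θf) − ΘB(Df)` and the second piece `P2 := Θ(D*(Df)) − D*(ΘB(Df))`
  set adf : BondL2K 𝕜 d Pd c₀ W := covDerivL2K 𝕜 c₀ c R (Θ f) - ΘB Df with hadf
  have hsplit : covDivL2K 𝕜 c₀ c' S (covDerivL2K 𝕜 c₀ c R (Θ f)) - Θ (covDivL2K 𝕜 c₀ c' S Df) =
      covDivL2K 𝕜 c₀ c' S adf - (Θ (covDivL2K 𝕜 c₀ c' S Df) - covDivL2K 𝕜 c₀ c' S (ΘB Df)) := by
    rw [hadf, map_sub]; abel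
  -- piece 2: the weighted divergence commutator at `A := Df`
  have hP2 : ‖Θ (covDivL2K 𝕜 c₀ c' S Df) - covDivL2K 𝕜 c₀ c' S (ΘB Df)‖ ≤ Real.sqrt d * (‖c'‖ * θ₁ * MT) * ‖WEm Df‖ :=
    norm_comm_covDivL2K_le_weighted ΘB Θ WEm hMT hS hθ₁ hwE h1 hΘB hΘ hWEm c' Df
  -- piece 1: the expansion of `D*(ad f)` — underlying functions
  have hΘf : WL2.equiv 𝕜 _ W (Θ f) = fun x => (σ x : 𝕜) • l x := funext (hΘ f)
  have hadf_fun : WL2.equiv 𝕜 _ W adf = fun b => covDeriv c R (fun x => (σ x : 𝕜) • l x) b - (σ (bpos b) : 𝕜) • covDeriv c R l b := by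
    funext b
    rw [hadf, WL2.equiv_sub, Pi.sub_apply, equiv_covDerivL2K, hΘf, hΘB, hDf, equiv_covDerivL2K]
  set P1a : SiteL2K 𝕜 d Pd c₀ W := (WL2.equiv 𝕜 (fun _ : TSite d Pd => c₀) W).symm
    (fun y => ((c' * c) * ((∑ μ : Fin d, ((σ y - σ (unshift μ y)) - (σ (shift μ y) - σ y)) : ℝ) : 𝕜)) • l y) with hP1a
  set P1b : SiteL2K 𝕜 d Pd c₀ W := (WL2.equiv 𝕜 (fun _ : TSite d Pd => c₀) W).symm
    (fun y => c' • ∑ μ : Fin d, ((σ (shift μ y) - σ y : ℝ) : 𝕜) • covDeriv c R l (y, μ)) with hP1b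
  have hP1 : covDivL2K 𝕜 c₀ c' S adf = P1a - P1b := by
    apply (WL2.equiv 𝕜 (fun _ : TSite d Pd => c₀) W).injective
    funext y
    rw [equiv_covDivL2K, hadf_fun, WL2.equiv_sub, Pi.sub_apply, hP1a, hP1b, Equiv.apply_symm_apply, Equiv.apply_symm_apply]
    have e := covDiv_comm_covDeriv_apply (fun x => (σ x : 𝕜)) c c' R S hSR l y
    rw [e]
    push_cast
    rw [smul_smul]
  -- ‖P1a‖ ≤ d‖c′‖‖c‖θ₂‖Wf‖ (pointwise domination by the site weight)
  have hP1a_le : ‖P1a‖ ≤ d * ‖c'‖ * ‖c‖ * θ₂ * ‖Wm f‖ := by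
    refine norm_le_of_pointwise_le P1a (Wm f) (by positivity) fun y => ?_
    rw [hP1a, Equiv.apply_symm_apply, norm_smul, norm_mul, norm_mul, RCLike.norm_ofReal, hWm, norm_real_smul (hw y), ← hl]
    have hs : |∑ μ : Fin d, ((σ y - σ (unshift μ y)) - (σ (shift μ y) - σ y))| ≤ d * (θ₂ * w y) := by
      calc _ ≤ ∑ μ : Fin d, |(σ y - σ (unshift μ y)) - (σ (shift μ y) - σ y)| := Finset.abs_sum_le_sum_abs _ _
        _ ≤ ∑ _μ : Fin d, θ₂ * w y := Finset.sum_le_sum fun μ _ => h2 y μ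
        _ = d * (θ₂ * w y) := by simp
    calc ‖c'‖ * ‖c‖ * |∑ μ : Fin d, ((σ y - σ (unshift μ y)) - (σ (shift μ y) - σ y))| * ‖l y‖
        ≤ ‖c'‖ * ‖c‖ * (d * (θ₂ * w y)) * ‖l y‖ := by gcongr
      _ = d * ‖c'‖ * ‖c‖ * θ₂ * (w y * ‖l y‖) := by ring
  -- ‖P1b‖ ≤ √d‖c′‖θ₁‖W_E(Df)‖ (out-star, the bond weight inside)
  have hP1b_le : ‖P1b‖ ≤ Real.sqrt d * (‖c'‖ * θ₁) * ‖WEm Df‖ := by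
    refine norm_site_le_of_outstar_bound (WEm Df) P1b (by positivity) fun y => ?_
    rw [hP1b, Equiv.apply_symm_apply, norm_smul, mul_assoc]
    refine mul_le_mul_of_nonneg_left ?_ (norm_nonneg _)
    rw [Finset.mul_sum]
    refine (norm_sum_le _ _).trans (Finset.sum_le_sum fun μ _ => ?_)
    rw [norm_smul, RCLike.norm_ofReal, hWEm, norm_real_smul (hwE _), hDf, equiv_covDerivL2K, ← hl]
    have h := h1 (y, μ)
    simp only [bpos, btgt] at h
    rw [abs_sub_comm] at h
    calc |σ (shift μ y) - σ y| * ‖covDeriv c R l (y, μ)‖ ≤ θ₁ * wE (y, μ) * ‖covDeriv c R l (y, μ)‖ :=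
          mul_le_mul_of_nonneg_right h (norm_nonneg _)
      _ = θ₁ * (wE (y, μ) * ‖covDeriv c R l (y, μ)‖) := by ring
  -- assemble
  rw [hsplit, hP1]
  calc ‖P1a - P1b - (Θ (covDivL2K 𝕜 c₀ c' S Df) - covDivL2K 𝕜 c₀ c' S (ΘB Df))‖
      ≤ ‖P1a‖ + ‖P1b‖ + ‖Θ (covDivL2K 𝕜 c₀ c' S Df) - covDivL2K 𝕜 c₀ c' S (ΘB Df)‖ :=
        (norm_sub_le _ _).trans (add_le_add (norm_sub_le _ _) le_rfl)
    _ ≤ d * ‖c'‖ * ‖c‖ * θ₂ * ‖Wm f‖ + Real.sqrt d * (‖c'‖ * θ₁) * ‖WEm Df‖ + Real.sqrt d * (‖c'‖ * θ₁ * MT) * ‖WEm Df‖ :=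
        add_le_add (add_le_add hP1a_le hP1b_le) hP2
    _ = Real.sqrt d * ‖c'‖ * θ₁ * (MT + 1) * ‖WEm Df‖ + d * ‖c'‖ * ‖c‖ * θ₂ * ‖Wm f‖ := by ring

end Lap

/-! ## §4 The cutoff tail against the weight: the `hτ` letter -/
section Tail
variable {𝕜 : Type*} [RCLike 𝕜] {X V : Type*} [Fintype X] [NormedAddCommGroup V] [InnerProductSpace 𝕜 V] {wt : X → ℝ} [Fact (∀ x, 0 < wt x)]

/-- **THE CUTOFF TAIL AGAINST THE WEIGHT**: maps `Θ`, `W` acting as multiplication by a real cutoff `σ` and a real weight `w ≥ 0` on ANY weighted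
carrier, with `|σ(x) − 1| ≤ τ·w(x)` pointwise (`0 ≤ τ`; e.g. `σ = 1` where `w < e^{κr}`, `0 ≤ σ ≤ 1`, `w = e^{κχ}` ⇒ `τ = e^{−κr}`): `‖Θf − f‖ ≤ τ‖Wf‖` —
the `hτ` shape of `B9Eq387CubeLocalisedProjection.norm_sub_projR_cube_le_weighted`. [folklore] [cite: Balaban1985BackgroundPropagators, (3.89) p.409, (3.49) p.399] -/
theorem norm_mul_sub_self_le_weighted {σ w : X → ℝ} {τ : ℝ} (hτ : 0 ≤ τ) (hw : ∀ x, 0 ≤ w x) (hστ : ∀ x, |σ x - 1| ≤ τ * w x)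
    (Θ Wm : WL2 𝕜 wt V → WL2 𝕜 wt V) (hΘ : ∀ (f : WL2 𝕜 wt V) (x : X), WL2.equiv 𝕜 wt V (Θ f) x = (σ x : 𝕜) • WL2.equiv 𝕜 wt V f x)
    (hWm : ∀ (f : WL2 𝕜 wt V) (x : X), WL2.equiv 𝕜 wt V (Wm f) x = (w x : 𝕜) • WL2.equiv 𝕜 wt V f x) (f : WL2 𝕜 wt V) :
    ‖Θ f - f‖ ≤ τ * ‖Wm f‖ := by
  refine norm_le_of_pointwise_le (Θ f - f) (Wm f) hτ fun x => ?_
  have e : WL2.equiv 𝕜 wt V (Θ f - f) x = ((σ x - 1 : ℝ) : 𝕜) • WL2.equiv 𝕜 wt V f x := by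
    rw [WL2.equiv_sub, Pi.sub_apply, hΘ, RCLike.ofReal_sub, RCLike.ofReal_one, sub_smul, one_smul]
  rw [e, norm_smul, RCLike.norm_ofReal, hWm, norm_real_smul (hw x)]
  calc |σ x - 1| * ‖WL2.equiv 𝕜 wt V f x‖ ≤ τ * w x * ‖WL2.equiv 𝕜 wt V f x‖ := mul_le_mul_of_nonneg_right (hστ x) (norm_nonneg _)
    _ = τ * (w x * ‖WL2.equiv 𝕜 wt V f x‖) := by ring

end Tail

/-! ## §5 The scalar averaging `Q′` against a site weight: the `hb` letter -/
section Bzero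
variable {d : ℕ} (L : ℕ) [NeZero L] (m : Fin d → ℕ) {W : Type*} [NormedAddCommGroup W] [InnerProductSpace ℂ W] {c₀ c₁ : ℝ}
  [Fact (0 < c₀)] [Fact (0 < c₁)] {Rb : Bond d (fineP L m) → W →ₗ[ℂ] W} {MA : ℝ}
  (hA : ∀ (y : TSite d m), ∀ x ∈ B9Eq319QprimeTorus.blockOf L m y, ∀ v : W,
    ‖pathTr (stepTransport L m fun b => (Rb b).restrictScalars ℝ) (centre L m y :: contour L m x) v‖ ≤ MA * ‖v‖)

include hA in
/-- **THE SINGLE `Q′` COMMUTATOR AGAINST A SITE WEIGHT, POINTWISE**: with `|χ′(y) − χ(x)| ≤ ϑ·ω(x)` for `x ∈ B(y)` (`ω ≥ 0`, `0 ≤ M_A`):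
`‖χ′(y)·(Q′λ)(y) − Q′(χλ)(y)‖ ≤ M_Aϑ·L^{−d}·Σ_{x∈B(y)} ‖ω(x)λ(x)‖`. [folklore] [cite: Balaban1985BackgroundPropagators, (3.102) p.414, (3.19) p.393] -/
theorem norm_comm_QprimeLin_apply_le_weighted (hMA : 0 ≤ MA) {χ' : TSite d m → ℝ} {χ ω : TSite d (fineP L m) → ℝ} {ϑ : ℝ}
    (hω : ∀ x, 0 ≤ ω x) (hb : ∀ (y : TSite d m), ∀ x ∈ B9Eq319QprimeTorus.blockOf L m y, |χ' y - χ x| ≤ ϑ * ω x)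
    (l : TSite d (fineP L m) → W) (y : TSite d m) :
    ‖(χ' y : ℂ) • QprimeLin L m Rb l y - QprimeLin L m Rb (fun x => (χ x : ℂ) • l x) y‖ ≤
      MA * ϑ * (((L : ℝ) ^ d)⁻¹ * ∑ x ∈ B9Eq319QprimeTorus.blockOf L m y, ‖(ω x : ℂ) • l x‖) := by
  have hw : 0 ≤ ((L : ℝ) ^ d)⁻¹ := by positivity
  refine (norm_comm_QprimeLin_apply_le L m hA χ' χ l y).trans ?_
  have hsum : ∑ x ∈ B9Eq319QprimeTorus.blockOf L m y, |χ' y - χ x| * ‖l x‖ ≤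
      ϑ * ∑ x ∈ B9Eq319QprimeTorus.blockOf L m y, ‖(ω x : ℂ) • l x‖ := by
    rw [Finset.mul_sum]
    refine Finset.sum_le_sum fun x hx => ?_
    rw [norm_smul, Complex.norm_real, Real.norm_eq_abs, abs_of_nonneg (hω x)]
    calc |χ' y - χ x| * ‖l x‖ ≤ ϑ * ω x * ‖l x‖ := mul_le_mul_of_nonneg_right (hb y x hx) (norm_nonneg _)
      _ = ϑ * (ω x * ‖l x‖) := mul_assoc _ _ _
  calc MA * (((L : ℝ) ^ d)⁻¹ * ∑ x ∈ B9Eq319QprimeTorus.blockOf L m y, |χ' y - χ x| * ‖l x‖)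
      ≤ MA * (((L : ℝ) ^ d)⁻¹ * (ϑ * ∑ x ∈ B9Eq319QprimeTorus.blockOf L m y, ‖(ω x : ℂ) • l x‖)) :=
        mul_le_mul_of_nonneg_left (mul_le_mul_of_nonneg_left hsum hw) hMA
    _ = MA * ϑ * (((L : ℝ) ^ d)⁻¹ * ∑ x ∈ B9Eq319QprimeTorus.blockOf L m y, ‖(ω x : ℂ) • l x‖) := by ring

include hA in
/-- **… IN `ℓ²` OVER THE COARSE TORUS** (Jensen on each block, the blocks partition the fine torus):
`Σ_y ‖χ′(y)·(Q′λ)(y) − Q′(χλ)(y)‖² ≤ (M_Aϑ)²·L^{−d}·Σ_x ‖ω(x)λ(x)‖²`. [folklore] [cite: Balaban1985BackgroundPropagators, (3.102) p.414, (3.11) p.392] -/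
theorem sum_norm_sq_comm_QprimeLin_le_weighted (hMA : 0 ≤ MA) {χ' : TSite d m → ℝ} {χ ω : TSite d (fineP L m) → ℝ} {ϑ : ℝ}
    (hω : ∀ x, 0 ≤ ω x) (hb : ∀ (y : TSite d m), ∀ x ∈ B9Eq319QprimeTorus.blockOf L m y, |χ' y - χ x| ≤ ϑ * ω x)
    (l : TSite d (fineP L m) → W) :
    ∑ y, ‖(χ' y : ℂ) • QprimeLin L m Rb l y - QprimeLin L m Rb (fun x => (χ x : ℂ) • l x) y‖ ^ 2 ≤
      (MA * ϑ) ^ 2 * (((L : ℝ) ^ d)⁻¹ * ∑ x, ‖(ω x : ℂ) • l x‖ ^ 2) := by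
  calc _ ≤ ∑ y, (MA * ϑ * (((L : ℝ) ^ d)⁻¹ * ∑ x ∈ B9Eq319QprimeTorus.blockOf L m y, ‖(ω x : ℂ) • l x‖)) ^ 2 :=
        Finset.sum_le_sum fun y _ => pow_le_pow_left₀ (norm_nonneg _) (norm_comm_QprimeLin_apply_le_weighted L m hA hMA hω hb l y) 2
    _ ≤ ∑ y, (MA * ϑ) ^ 2 * (((L : ℝ) ^ d)⁻¹ * ∑ x ∈ B9Eq319QprimeTorus.blockOf L m y, ‖(ω x : ℂ) • l x‖ ^ 2) :=
        Finset.sum_le_sum fun y _ => by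
          rw [mul_pow]; exact mul_le_mul_of_nonneg_left (blockMean_norm_sq_le L m (fun x => (ω x : ℂ) • l x) y) (sq_nonneg _)
    _ = (MA * ϑ) ^ 2 * (((L : ℝ) ^ d)⁻¹ * ∑ x, ‖(ω x : ℂ) • l x‖ ^ 2) := by
        rw [← Finset.mul_sum, ← Finset.mul_sum, sum_blockOf_sum]

variable (T : SiteL2K ℂ d (fineP L m) c₀ W → WL2 ℂ (fun _ : TSite d m => c₁) W)
  (hT : ∀ (f : SiteL2K ℂ d (fineP L m) c₀ W) (y : TSite d m),
    WL2.equiv ℂ (fun _ : TSite d m => c₁) W (T f) y = QprimeLin L m Rb (WL2.equiv ℂ (fun _ : TSite d (fineP L m) => c₀) W f) y)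
  {χ' : TSite d m → ℝ} {χ ω : TSite d (fineP L m) → ℝ} {ϑ : ℝ}
  (χS Wm : SiteL2K ℂ d (fineP L m) c₀ W → SiteL2K ℂ d (fineP L m) c₀ W) (χG : WL2 ℂ (fun _ : TSite d m => c₁) W → WL2 ℂ (fun _ : TSite d m => c₁) W)
  (hS : ∀ (f : SiteL2K ℂ d (fineP L m) c₀ W) (x : TSite d (fineP L m)),
    WL2.equiv ℂ (fun _ : TSite d (fineP L m) => c₀) W (χS f) x = (χ x : ℂ) • WL2.equiv ℂ (fun _ : TSite d (fineP L m) => c₀) W f x)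
  (hWm : ∀ (f : SiteL2K ℂ d (fineP L m) c₀ W) (x : TSite d (fineP L m)),
    WL2.equiv ℂ (fun _ : TSite d (fineP L m) => c₀) W (Wm f) x = (ω x : ℂ) • WL2.equiv ℂ (fun _ : TSite d (fineP L m) => c₀) W f x)
  (hG : ∀ (g : WL2 ℂ (fun _ : TSite d m => c₁) W) (y : TSite d m),
    WL2.equiv ℂ (fun _ : TSite d m => c₁) W (χG g) y = (χ' y : ℂ) • WL2.equiv ℂ (fun _ : TSite d m => c₁) W g y)

omit [Fact (0 < c₁)] in
/-- the weights' bookkeeping: `c₁·(L^{−d}·S) = (c₁(c₀L^d)⁻¹)·(c₀·S)` (private arithmetic helper). [folklore] -/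
private theorem weight_identity (S : ℝ) : c₁ * (((L : ℝ) ^ d)⁻¹ * S) = c₁ * (c₀ * (L : ℝ) ^ d)⁻¹ * (c₀ * S) := by
  have hc₀ : 0 < c₀ := Fact.out
  have hL : (0 : ℝ) < (L : ℝ) ^ d := pow_pos (by exact_mod_cast Nat.pos_of_ne_zero (NeZero.ne L)) d
  field_simp

omit [Fact (0 < c₁)] in
/-- at `c₁ = L^d·c₀` the weight factor is `1` (private arithmetic helper). [folklore] -/
private theorem weight_factor_eq_one (hc : c₁ = (L : ℝ) ^ d * c₀) : c₁ * (c₀ * (L : ℝ) ^ d)⁻¹ = 1 := by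
  have hc₀ : 0 < c₀ := Fact.out
  have hL : (0 : ℝ) < (L : ℝ) ^ d := pow_pos (by exact_mod_cast Nat.pos_of_ne_zero (NeZero.ne L)) d
  rw [hc]; field_simp

include hA hT hS hWm hG in
/-- **THE `b₀` LETTER AGAINST A SITE WEIGHT ON THE CARRIERS**: `χ_S` (fine, by `χ`), `χ_G` (coarse, by `χ′`), `W` (fine, by a real `ω ≥ 0`),
`|χ′(y) − χ(x)| ≤ ϑ·ω(x)` on `x ∈ B(y)`, transports `≤ M_A`, `T` acting as the scalar `Q̃′` (3.19):
`‖T(χ_Sλ) − χ_G(Tλ)‖ ≤ M_Aϑ·√(c₁(c₀L^d)⁻¹)·‖Wλ‖`. [folklore] [cite: Balaban1985BackgroundPropagators, (3.102) p.414, (3.19) p.393, (3.11) p.392] -/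
theorem norm_comm_T_le_weighted (hMA : 0 ≤ MA) (hϑ : 0 ≤ ϑ) (hω : ∀ x, 0 ≤ ω x)
    (hb : ∀ (y : TSite d m), ∀ x ∈ B9Eq319QprimeTorus.blockOf L m y, |χ' y - χ x| ≤ ϑ * ω x) (f : SiteL2K ℂ d (fineP L m) c₀ W) :
    ‖T (χS f) - χG (T f)‖ ≤ MA * ϑ * Real.sqrt (c₁ * (c₀ * (L : ℝ) ^ d)⁻¹) * ‖Wm f‖ := by
  have hc₀ : 0 < c₀ := Fact.out
  have hc₁ : 0 < c₁ := Fact.out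
  have hK : 0 ≤ c₁ * (c₀ * (L : ℝ) ^ d)⁻¹ := by positivity
  set l : TSite d (fineP L m) → W := WL2.equiv ℂ (fun _ : TSite d (fineP L m) => c₀) W f with hl
  have hSf : WL2.equiv ℂ (fun _ : TSite d (fineP L m) => c₀) W (χS f) = fun x => (χ x : ℂ) • l x := funext (hS f)
  have e : ∀ y, WL2.equiv ℂ (fun _ : TSite d m => c₁) W (χG (T f) - T (χS f)) y =
      (χ' y : ℂ) • QprimeLin L m Rb l y - QprimeLin L m Rb (fun x => (χ x : ℂ) • l x) y := fun y => by
    rw [WL2.equiv_sub, Pi.sub_apply, hG, hT, hT, hSf]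
  have hsq : ‖χG (T f) - T (χS f)‖ ^ 2 ≤ (MA * ϑ * ‖Wm f‖) ^ 2 * (c₁ * (c₀ * (L : ℝ) ^ d)⁻¹) := by
    rw [WL2.norm_sq, mul_pow, WL2.norm_sq (Wm f)]
    simp only [e, hWm]
    rw [← Finset.mul_sum, ← Finset.mul_sum]
    calc c₁ * ∑ y, ‖(χ' y : ℂ) • QprimeLin L m Rb l y - QprimeLin L m Rb (fun x => (χ x : ℂ) • l x) y‖ ^ 2
        ≤ c₁ * ((MA * ϑ) ^ 2 * (((L : ℝ) ^ d)⁻¹ * ∑ x, ‖(ω x : ℂ) • l x‖ ^ 2)) :=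
          mul_le_mul_of_nonneg_left (sum_norm_sq_comm_QprimeLin_le_weighted L m hA hMA hω hb l) hc₁.le
      _ = (MA * ϑ) ^ 2 * (c₀ * ∑ x, ‖(ω x : ℂ) • l x‖ ^ 2) * (c₁ * (c₀ * (L : ℝ) ^ d)⁻¹) := by
          rw [mul_left_comm, weight_identity L (c₀ := c₀)]; ring
  have h' : ‖χG (T f) - T (χS f)‖ ^ 2 ≤ (MA * ϑ * Real.sqrt (c₁ * (c₀ * (L : ℝ) ^ d)⁻¹) * ‖Wm f‖) ^ 2 := by
    calc _ ≤ (MA * ϑ * ‖Wm f‖) ^ 2 * (c₁ * (c₀ * (L : ℝ) ^ d)⁻¹) := hsq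
      _ = (MA * ϑ * Real.sqrt (c₁ * (c₀ * (L : ℝ) ^ d)⁻¹) * ‖Wm f‖) ^ 2 := by
          rw [show (MA * ϑ * Real.sqrt (c₁ * (c₀ * (L : ℝ) ^ d)⁻¹) * ‖Wm f‖) ^ 2 =
            (MA * ϑ * ‖Wm f‖) ^ 2 * (Real.sqrt (c₁ * (c₀ * (L : ℝ) ^ d)⁻¹)) ^ 2 by ring, Real.sq_sqrt hK]
  rw [norm_sub_rev]
  exact (pow_le_pow_iff_left₀ (norm_nonneg _) (by positivity) two_ne_zero).1 h'

include hA hT hS hWm hG in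
/-- **`b₀ = M_Aϑ` AT THE DIAGONAL `c₁ = L^dc₀`** — the `hb` hypothesis of `B9Eq387CubeLocalisedProjection.norm_sub_projR_cube_le_weighted` (`Q′ := T`,
`θ := χ_S`, `θ_F := χ_G`, `W := W`): `‖T(χ_Sλ) − χ_G(Tλ)‖ ≤ M_Aϑ·‖Wλ‖` — no `η`, no `L`, no volume; with `χ` flat where `ω < e^{κr}` the consumer reads
`ϑ = (osc χ)·e^{−κr}` (§6). [folklore] [cite: Balaban1985BackgroundPropagators, (3.102) p.414, (3.89) p.409] -/
theorem norm_comm_T_le_weighted_diagonal (hMA : 0 ≤ MA) (hϑ : 0 ≤ ϑ) (hω : ∀ x, 0 ≤ ω x)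
    (hb : ∀ (y : TSite d m), ∀ x ∈ B9Eq319QprimeTorus.blockOf L m y, |χ' y - χ x| ≤ ϑ * ω x) (hc : c₁ = (L : ℝ) ^ d * c₀)
    (f : SiteL2K ℂ d (fineP L m) c₀ W) : ‖T (χS f) - χG (T f)‖ ≤ MA * ϑ * ‖Wm f‖ := by
  have h := norm_comm_T_le_weighted L m hA T hT χS Wm χG hS hWm hG hMA hϑ hω hb f
  rwa [weight_factor_eq_one L (c₀ := c₀) hc, Real.sqrt_one, mul_one] at h

end Bzero

/-! ## §6 The extraction of smallness: a cutoff flat where the weight is small -/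
section Extraction

/-- **FLAT WHERE THE WEIGHT IS SMALL ⇒ DOMINATED BY THE WEIGHT**: an increment `δ` with `|δ| ≤ θ` (`0 ≤ θ`) which VANISHES unless `m ≤ w` (`0 < m`,
`0 ≤ w`) obeys `|δ| ≤ (θ∕m)·w` — the weighted letters `h1`, `h2`, `hστ`, `hb` of §§2–5 from uniform profile letters plus the support of the increments.
[folklore] [cite: Balaban1985BackgroundPropagators, (3.89) p.409] -/
theorem abs_le_div_mul_of_support {δ θ m w : ℝ} (hδ : |δ| ≤ θ) (hθ : 0 ≤ θ) (hm : 0 < m) (hw : 0 ≤ w) (hsupp : δ ≠ 0 → m ≤ w) :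
    |δ| ≤ θ / m * w := by
  by_cases h0 : δ = 0
  · rw [h0, abs_zero]; positivity
  · calc |δ| ≤ θ := hδ
      _ = θ / m * m := by field_simp
      _ ≤ θ / m * w := mul_le_mul_of_nonneg_left (hsupp h0) (by positivity)

/-- **THE EXPONENTIAL READING**: with the weight `w = e^{κρ}` (`0 ≤ κ`) and the increment supported where `r ≤ ρ`: `|δ| ≤ θe^{−κr}·e^{κρ}` — the
smallness `e^{−κr}` of the weighted letters (`θ₁ ↦ θ₁e^{−κr}`, `θ₂ ↦ θ₂e^{−κr}`, `τ = e^{−κr}`, `ϑ ↦ ϑe^{−κr}`). [folklore] [cite: Balaban1985BackgroundPropagators, (3.89) p.409, (3.49) p.399] -/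
theorem abs_le_mul_exp_of_support {δ θ κ r ρ : ℝ} (hδ : |δ| ≤ θ) (hθ : 0 ≤ θ) (hκ : 0 ≤ κ) (hsupp : δ ≠ 0 → r ≤ ρ) :
    |δ| ≤ θ * Real.exp (-(κ * r)) * Real.exp (κ * ρ) := by
  have h := abs_le_div_mul_of_support hδ hθ (Real.exp_pos (κ * r)) (Real.exp_pos (κ * ρ)).le
    fun h0 => Real.exp_le_exp.2 (mul_le_mul_of_nonneg_left (hsupp h0) hκ)
  rwa [div_eq_mul_inv, ← Real.exp_neg] at h

/-- **ONE LATTICE STEP COSTS `e^{κℓ}`**: for `|ρ′ − ρ| ≤ ℓ` and `0 ≤ κ`, `e^{κρ′} ≤ e^{κℓ}·e^{κρ}` — the comparison of the bond weight `w_E(b) = w(b₋)`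
with the site weight at either end when `ρ` is `ℓ`-Lipschitz per bond. [folklore] [cite: Balaban1985BackgroundPropagators, (3.49) p.399] -/
theorem exp_weight_step_le {κ ℓ ρ ρ' : ℝ} (hκ : 0 ≤ κ) (h : |ρ' - ρ| ≤ ℓ) : Real.exp (κ * ρ') ≤ Real.exp (κ * ℓ) * Real.exp (κ * ρ) := by
  rw [← Real.exp_add, Real.exp_le_exp]
  have h' : ρ' - ρ ≤ ℓ := (le_abs_self _).trans h
  nlinarith

end Extraction

/-! ## §7 Non-vacuity: at the unit weights the weighted `K(h)` letter is the near-field one -/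
section Sanity
variable {𝕜 : Type*} [RCLike 𝕜] {d : ℕ} {Pd : Fin d → ℕ} {W : Type*} [NormedAddCommGroup W] [InnerProductSpace 𝕜 W]
  {c₀ : ℝ} [Fact (0 < c₀)] {R S : Bond d Pd → W →ₗ[𝕜] W} {MT : ℝ}

/-- At `w ≡ 1`, `w_E ≡ 1`, `W = W_E = id` the weighted hypotheses are the uniform ones and `norm_lap_comm_le_weighted` returns EXACTLY the
near-field bound of `B9Eq388KhCommutatorLattice.norm_lap_comm_le`. [cite: Balaban1985BackgroundPropagators, (3.88) p.409, (3.100) p.413] -/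
example (hMT : 0 ≤ MT) (hS : ∀ b v, ‖S b v‖ ≤ MT * ‖v‖) (hSR : ∀ b v, S b (R b v) = v)
    {σ : TSite d Pd → ℝ} {θ₁ θ₂ : ℝ} (hθ₁ : 0 ≤ θ₁) (hθ₂ : 0 ≤ θ₂)
    (h1 : ∀ b : Bond d Pd, |σ (bpos b) - σ (btgt b)| ≤ θ₁)
    (h2 : ∀ (y : TSite d Pd) (μ : Fin d), |(σ y - σ (unshift μ y)) - (σ (shift μ y) - σ y)| ≤ θ₂)
    (Θ : SiteL2K 𝕜 d Pd c₀ W → SiteL2K 𝕜 d Pd c₀ W) (ΘB : BondL2K 𝕜 d Pd c₀ W → BondL2K 𝕜 d Pd c₀ W)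
    (hΘ : ∀ (f : SiteL2K 𝕜 d Pd c₀ W) (x : TSite d Pd), WL2.equiv 𝕜 _ W (Θ f) x = (σ x : 𝕜) • WL2.equiv 𝕜 _ W f x)
    (hΘB : ∀ (A : BondL2K 𝕜 d Pd c₀ W) (b : Bond d Pd), WL2.equiv 𝕜 _ W (ΘB A) b = (σ (bpos b) : 𝕜) • WL2.equiv 𝕜 _ W A b)
    (c c' : 𝕜) (f : SiteL2K 𝕜 d Pd c₀ W) :
    ‖covDivL2K 𝕜 c₀ c' S (covDerivL2K 𝕜 c₀ c R (Θ f)) - Θ (covDivL2K 𝕜 c₀ c' S (covDerivL2K 𝕜 c₀ c R f))‖ ≤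
      Real.sqrt d * ‖c'‖ * θ₁ * (MT + 1) * ‖covDerivL2K 𝕜 c₀ c R f‖ + d * ‖c'‖ * ‖c‖ * θ₂ * ‖f‖ := by
  have h := norm_lap_comm_le_weighted hMT hS hSR (w := fun _ => 1) (wE := fun _ => 1) hθ₁ hθ₂ (fun _ => zero_le_one) (fun _ => zero_le_one)
    (fun b => by simpa using h1 b) (fun y μ => by simpa using h2 y μ) Θ id ΘB id hΘ hΘB (fun f x => by simp) (fun A b => by simp) c c' f
  simpa using h

end Sanity

end Literature.MathematicalPhysics.QuantumFieldTheory.Balaban1983to89.B9Eq388KhCommutatorWeighted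

end
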